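import Summits.Ventures.Crystal3D.Theorems.StickyWulffConstantPolycrystalWulffBoundMergingCalculus

/-!
# `PolycrystalWulffBound`, line `PolyDensity`: the TWO-CLASS MERGE — the energy of a texture whose
# grains carry only two bodies dominates the energy of the merged two-grain texture
# (crux `stmt-Ventures-19482`; P-map item «single-axis residual ≡ two-phase inequality», memo P-L2-g15 §5(7))

Route `StickyWulffConstant` of the venture `Summits/Ventures/Crystal3D`, second prover lane (poly-p2,
gen 15).  Co-axial fcc lattices about one axis carry only two Wulff bodies (`W` and its `π`-rotated
twin, `cruxWulffBody_eq_or_eq_reflection_image`), the walls inside a body class are charged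
non-negatively, and walls across the classes are charged at least `c₀` (`= ½`) against one common
kernel `D₀` (`= Dsc m`).  For pairwise disjoint polyhedral grains of finite volume this file proves the
bookkeeping inequality

  `[per K₁ S₁ − ι_{K₁}(S₁,S₂)] + [per K₂ S₂ − ι_{K₂}(S₂,S₁)] + c₀·ι_{D₀}(S₁,S₂)`
  `   ≤ Σ_f [per K_{cls f} (G f) − Σ_{g≠f} ι_{K_{cls f}}(G f, G g)] + Σ_{f≠g} (c f g/2)·ι_{D f g}(G f, G g)`

(`energy_twoClassMerged_le`; `S_b = ⋃_{cls f = b} G f`, `ι_K(S,T) = (per K S + per K T − per K (S ∪ T))/2`):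
the free energies AGREE (`freeEnergy_eq_merged_texture`, inclusion–exclusion for polyhedral grains) and
the wall term only loses the non-negative same-class walls (`iota_nonneg_of_poly`) and the excess charge
`c f g − c₀`, the cross-class interfaces adding up by bilinearity (`two_iota_biUnion_biUnion`).
CONSEQUENCE (the reduction booked in memo P-L2-g15 §5(7)): the crux on ALL single-axis polyhedral
textures follows from the crux on TWO-GRAIN co-axial textures `(S₁, S₂)` at charge `½` — i.e. the
single-axis residual of the P map is ONE two-phase twin inequality
`F(E,S) ≥ 6·2^{1/3}(√2·|E|)^{2/3}`.
WHAT THIS IS NOT: the two-phase inequality itself; anything about generic (non-co-axial) walls; the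
crux is not claimed.
-/

noncomputable section

namespace Summit.Ventures.Crystal3D.Theorems

open MeasureTheory Set Metric
open scoped RealInnerProductSpace ENNReal Pointwise
open Summit.Ventures.Crystal3D.Cruxes.TextureLiminf.TexShadow
open Literature.Analysis.Convexity

/-- **Two-class merge.**  Pairwise disjoint polyhedral grains `G f` of finite volume, a class map
`cls : Fin n → Bool`, class bodies `K b` and pair kernels `D f g` (all origin-symmetric compact convex
`∋ 0`), a common cross-class kernel `D₀` (`D f g = D₀` whenever `cls f ≠ cls g`), charges `c f g ≥ 0`
with `c f g ≥ c₀` across the classes.  Then the energy of the merged two-grain texture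
`(S_true, S_false)`, `S_b = ⋃_{cls f = b} G f`, with cross charge `c₀` is at most the energy of the
texture. -/
theorem energy_twoClassMerged_le {n : ℕ} (G : Fin n → Set E3)
    (hPoly : ∀ f, ∃ (k : ℕ) (H : Fin k → Finset (E3 × ℝ)), G f = ⋃ i, polytope (H i))
    (hvol : ∀ f, volume (G f) < ⊤) (hdisjG : ∀ f g, f ≠ g → Disjoint (G f) (G g))
    (cls : Fin n → Bool) (K : Bool → Set E3) (hKc : ∀ b, IsCompact (K b)) (hKv : ∀ b, Convex ℝ (K b))
    (hK0 : ∀ b, (0 : E3) ∈ K b) (hKs : ∀ b, -K b = K b)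
    (D : Fin n → Fin n → Set E3) (hDc : ∀ f g, IsCompact (D f g)) (hDv : ∀ f g, Convex ℝ (D f g))
    (hD0 : ∀ f g, (0 : E3) ∈ D f g)
    (D₀ : Set E3) (hD₀c : IsCompact D₀) (hD₀v : Convex ℝ D₀) (hD₀0 : (0 : E3) ∈ D₀) (hD₀s : -D₀ = D₀)
    (hDD₀ : ∀ f g, cls f ≠ cls g → D f g = D₀)
    (c : Fin n → Fin n → ℝ) (hc0 : ∀ f g, f ≠ g → 0 ≤ c f g) (c₀ : ℝ)
    (hcc₀ : ∀ f g, cls f ≠ cls g → c₀ ≤ c f g) :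
    (per (K true) (⋃ f ∈ Finset.univ.filter (fun f => cls f = true), G f) -
        (per (K true) (⋃ f ∈ Finset.univ.filter (fun f => cls f = true), G f) +
          per (K true) (⋃ f ∈ Finset.univ.filter (fun f => cls f = false), G f) -
          per (K true) ((⋃ f ∈ Finset.univ.filter (fun f => cls f = true), G f) ∪
            ⋃ f ∈ Finset.univ.filter (fun f => cls f = false), G f)) / 2) +
      (per (K false) (⋃ f ∈ Finset.univ.filter (fun f => cls f = false), G f) -
        (per (K false) (⋃ f ∈ Finset.univ.filter (fun f => cls f = false), G f) +
          per (K false) (⋃ f ∈ Finset.univ.filter (fun f => cls f = true), G f) -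
          per (K false) ((⋃ f ∈ Finset.univ.filter (fun f => cls f = false), G f) ∪
            ⋃ f ∈ Finset.univ.filter (fun f => cls f = true), G f)) / 2) +
      c₀ * ((per D₀ (⋃ f ∈ Finset.univ.filter (fun f => cls f = true), G f) +
          per D₀ (⋃ f ∈ Finset.univ.filter (fun f => cls f = false), G f) -
          per D₀ ((⋃ f ∈ Finset.univ.filter (fun f => cls f = true), G f) ∪
            ⋃ f ∈ Finset.univ.filter (fun f => cls f = false), G f)) / 2) ≤
    (∑ f, (per (K (cls f)) (G f) - ∑ g, (if f = g then 0 else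
        (per (K (cls f)) (G f) + per (K (cls f)) (G g) - per (K (cls f)) (G f ∪ G g)) / 2))) +
      ∑ f, ∑ g, (if f = g then 0 else
        c f g / 2 * ((per (D f g) (G f) + per (D f g) (G g) - per (D f g) (G f ∪ G g)) / 2)) := by
  classical
  set I : Finset (Fin n) := Finset.univ.filter (fun f => cls f = true) with hI
  set J : Finset (Fin n) := Finset.univ.filter (fun f => cls f = false) with hJ
  set S₁ : Set E3 := ⋃ f ∈ I, G f with hS₁
  set S₂ : Set E3 := ⋃ f ∈ J, G f with hS₂
  -- (1) the free energies agree
  have hfree := freeEnergy_eq_merged_texture G hPoly hvol hdisjG cls Finset.univ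
    (fun f => Finset.mem_univ _) K hKc hKv hK0 hKs
  have hfree' : (∑ f, (per (K (cls f)) (G f) - ∑ g, (if f = g then 0 else
        (per (K (cls f)) (G f) + per (K (cls f)) (G g) - per (K (cls f)) (G f ∪ G g)) / 2))) =
      (per (K true) S₁ - (per (K true) S₁ + per (K true) S₂ - per (K true) (S₁ ∪ S₂)) / 2) +
      (per (K false) S₂ - (per (K false) S₂ + per (K false) S₁ - per (K false) (S₂ ∪ S₁)) / 2) := by
    rw [hfree, Fintype.sum_bool, Fintype.sum_bool, Fintype.sum_bool]
    simp only [if_true, Bool.true_eq_false, if_false, Bool.false_eq_true, hS₁, hS₂, hI, hJ]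
    ring
  -- (2) the wall term
  set T : Fin n → Fin n → ℝ := fun f g => if f = g then 0 else
      c f g / 2 * ((per (D f g) (G f) + per (D f g) (G g) - per (D f g) (G f ∪ G g)) / 2) with hT
  have hι0 : ∀ f g, f ≠ g → ∀ (L : Set E3), IsCompact L → Convex ℝ L → (0 : E3) ∈ L →
      0 ≤ per L (G f) + per L (G g) - per L (G f ∪ G g) :=
    fun f g hfg L hL hLv hL0 => iota_nonneg_of_poly G hPoly hvol hdisjG hL hLv hL0 hfg
  have hT0 : ∀ f g, 0 ≤ T f g := by
    intro f g
    by_cases hfg : f = g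
    · simp [hT, hfg]
    · simp only [hT, if_neg hfg]
      exact mul_nonneg (div_nonneg (hc0 f g hfg) (by norm_num))
        (div_nonneg (hι0 f g hfg (D f g) (hDc f g) (hDv f g) (hD0 f g)) (by norm_num))
  -- cross pairs dominate `(c₀/2)·ι_{D₀}`
  set U : Fin n → Fin n → ℝ := fun f g =>
      (per D₀ (G f) + per D₀ (G g) - per D₀ (G f ∪ G g)) with hU
  have hTU : ∀ f ∈ I, ∀ g ∈ J, c₀ / 2 * (U f g / 2) ≤ T f g := by
    intro f hf g hg
    have hcf : cls f = true := (Finset.mem_filter.1 hf).2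
    have hcg : cls g = false := (Finset.mem_filter.1 hg).2
    have hne : cls f ≠ cls g := by rw [hcf, hcg]; decide
    have hfg : f ≠ g := fun h => by rw [h, hcg] at hcf; exact absurd hcf (by decide)
    simp only [hT, if_neg hfg, hDD₀ f g hne, hU]
    have hιnn := hι0 f g hfg D₀ hD₀c hD₀v hD₀0
    exact mul_le_mul_of_nonneg_right (div_le_div_of_nonneg_right (hcc₀ f g hne) (by norm_num))
      (div_nonneg hιnn (by norm_num))
  have hTU' : ∀ f ∈ J, ∀ g ∈ I, c₀ / 2 * (U f g / 2) ≤ T f g := by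
    intro f hf g hg
    have hcf : cls f = false := (Finset.mem_filter.1 hf).2
    have hcg : cls g = true := (Finset.mem_filter.1 hg).2
    have hne : cls f ≠ cls g := by rw [hcf, hcg]; decide
    have hfg : f ≠ g := fun h => by rw [h, hcg] at hcf; exact absurd hcf (by decide)
    simp only [hT, if_neg hfg, hDD₀ f g hne, hU]
    have hιnn := hι0 f g hfg D₀ hD₀c hD₀v hD₀0
    exact mul_le_mul_of_nonneg_right (div_le_div_of_nonneg_right (hcc₀ f g hne) (by norm_num))
      (div_nonneg hιnn (by norm_num))
  -- split the double sum: all terms are nonnegative, keep only `I × J` and `J × I`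
  have hIJ : Disjoint I J := by
    rw [Finset.disjoint_left]
    intro f hf hf'
    have h1 : cls f = true := (Finset.mem_filter.1 hf).2
    have h2 : cls f = false := (Finset.mem_filter.1 hf').2
    rw [h1] at h2; exact absurd h2 (by decide)
  have hIJu : I ∪ J = Finset.univ := by
    ext f
    rw [Finset.mem_union, hI, hJ, Finset.mem_filter, Finset.mem_filter]
    simp only [Finset.mem_univ, true_and, iff_true]
    cases cls f <;> simp
  have hsum_ge : c₀ / 2 * ((∑ f ∈ I, ∑ g ∈ J, U f g) / 2) + c₀ / 2 * ((∑ f ∈ J, ∑ g ∈ I, U f g) / 2) ≤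
      ∑ f, ∑ g, T f g := by
    have h1 : (∑ f, ∑ g, T f g) = ∑ f ∈ I ∪ J, ∑ g ∈ I ∪ J, T f g := by rw [hIJu]
    rw [h1, Finset.sum_union hIJ]
    have hA : c₀ / 2 * ((∑ f ∈ I, ∑ g ∈ J, U f g) / 2) ≤ ∑ f ∈ I, ∑ g ∈ I ∪ J, T f g := by
      rw [show c₀ / 2 * ((∑ f ∈ I, ∑ g ∈ J, U f g) / 2) = ∑ f ∈ I, ∑ g ∈ J, c₀ / 2 * (U f g / 2) by
        rw [Finset.sum_div, Finset.mul_sum]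
        refine Finset.sum_congr rfl fun f _ => ?_
        rw [Finset.sum_div, Finset.mul_sum]]
      refine Finset.sum_le_sum fun f hf => ?_
      calc (∑ g ∈ J, c₀ / 2 * (U f g / 2)) ≤ ∑ g ∈ J, T f g := Finset.sum_le_sum fun g hg => hTU f hf g hg
        _ ≤ ∑ g ∈ I ∪ J, T f g :=
            Finset.sum_le_sum_of_subset_of_nonneg Finset.subset_union_right fun g _ _ => hT0 f g
    have hB : c₀ / 2 * ((∑ f ∈ J, ∑ g ∈ I, U f g) / 2) ≤ ∑ f ∈ J, ∑ g ∈ I ∪ J, T f g := by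
      rw [show c₀ / 2 * ((∑ f ∈ J, ∑ g ∈ I, U f g) / 2) = ∑ f ∈ J, ∑ g ∈ I, c₀ / 2 * (U f g / 2) by
        rw [Finset.sum_div, Finset.mul_sum]
        refine Finset.sum_congr rfl fun f _ => ?_
        rw [Finset.sum_div, Finset.mul_sum]]
      refine Finset.sum_le_sum fun f hf => ?_
      calc (∑ g ∈ I, c₀ / 2 * (U f g / 2)) ≤ ∑ g ∈ I, T f g := Finset.sum_le_sum fun g hg => hTU' f hf g hg
        _ ≤ ∑ g ∈ I ∪ J, T f g :=
            Finset.sum_le_sum_of_subset_of_nonneg Finset.subset_union_left fun g _ _ => hT0 f g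
    linarith
  -- bilinearity of the interfaces over the two classes
  have hbil : per D₀ S₁ + per D₀ S₂ - per D₀ (S₁ ∪ S₂) = ∑ f ∈ I, ∑ g ∈ J, U f g :=
    two_iota_biUnion_biUnion G hPoly hvol hdisjG hD₀c hD₀v hD₀0 hD₀s hIJ
  have hbil' : per D₀ S₂ + per D₀ S₁ - per D₀ (S₂ ∪ S₁) = ∑ f ∈ J, ∑ g ∈ I, U f g :=
    two_iota_biUnion_biUnion G hPoly hvol hdisjG hD₀c hD₀v hD₀0 hD₀s hIJ.symm
  have hwall : c₀ * ((per D₀ S₁ + per D₀ S₂ - per D₀ (S₁ ∪ S₂)) / 2) ≤ ∑ f, ∑ g, T f g := by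
    have e : c₀ * ((per D₀ S₁ + per D₀ S₂ - per D₀ (S₁ ∪ S₂)) / 2) =
        c₀ / 2 * ((∑ f ∈ I, ∑ g ∈ J, U f g) / 2) + c₀ / 2 * ((∑ f ∈ J, ∑ g ∈ I, U f g) / 2) := by
      rw [← hbil, ← hbil', union_comm S₂ S₁]; ring
    rw [e]; exact hsum_ge
  -- assemble
  rw [hfree']
  have hTsum : (∑ f, ∑ g, T f g) = ∑ f, ∑ g, (if f = g then 0 else
      c f g / 2 * ((per (D f g) (G f) + per (D f g) (G g) - per (D f g) (G f ∪ G g)) / 2)) := rfl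
  rw [← hTsum]
  linarith [hwall]

end Summit.Ventures.Crystal3D.Theorems

end
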